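import Literature.Analysis.FluidPDE.FractionalNSReynoldsL2Limit
import Literature.Analysis.FluidPDE.FractionalNSReynoldsLimit
import Literature.Analysis.FluidPDE.Antidivergence
import Literature.Barriers.NavierStokesRegularity.LionsExponentSharpnessProofs
import HarnessLib

/-!
# Luo–Titi 2020, Theorem 1 from the Iteration Lemma: the scheme run for the shear-flow datum

Sibling proof file of the barrier entry
`Literature/Barriers/NavierStokesRegularity/LionsExponentSharpness` (D-0021) and of
`LionsExponentSharpnessProofs` (which vendors the main clause of Luo–Titi's Theorem 1 as the
named fact `LuoTiti2020_thm1` and proves the consequence clause from it). Here the consequence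
clause — the catalogue's named fact `LuoTiti2020_infinitelyMany` = `LionsExponentSharpness` — is
proved from the deeper named fact `Torus.LuoTiti2020_iterationLemma`
(`Literature/Analysis/FluidPDE/FractionalNSReynolds`: Luo–Titi 2020, §2.1, the Iteration Lemma
= Lemma 1 of arXiv:1808.07595, one step of the intermittent convex-integration scheme), by
formalising the printed proof of Theorem 1 (p. 4 of the held arXiv text) for the paper's own test
datum `u(t, x) = φ(t) cos(2πx₂) e₁` (`LuoTiti2020.shearFlow` of `LionsExponentSharpnessProofs`):

> "Let `v₀ = u`. … Let `R₀ = ℛ(∂ₜv₀ + ν(-Δ)^θ v₀) + v₀ ⊗ v₀ + p₀ I` … Clearly `(v₀, R₀)` solves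
> (2.1). Set `δ₁ = ‖R₀‖_{L^∞_t L¹_x}`, `δ_{q+1} = 2^{-q} ε₀` for `q ≥ 1`. Apply Lemma 2.1
> iteratively to obtain smooth solution[s] `(v_q, R_q)` to (2.1). It follows from (2.4) that
> `∑ ‖v_{q+1} - v_q‖_{L^∞_t L²_x} ≤ C ∑ δ_{q+1}^{1/2} < ∞`. Thus `v_q` converge strongly to some
> `v ∈ C⁰_t L²_x`. Since `‖R_{q+1}‖_{L^∞_t L¹_x} → 0`, as `q → ∞`, `v` is a weak solution to the
> FVNSE (1.1). Estimate (2.5) leads to `‖v - v₀‖ ≤ ∑ δ_{q+1} ≤ ε₀`. Furthermore, it follows from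
> (2.3) that `supp_t v ⊂ N_{δ₁+ε₀}(supp_t u)`."

## Contents (all proved)

* `LuoTiti2020.fracLaplacian_shearField` — the shear field `U = cos(2πx₂)e₁` is an eigenfunction,
  `(-Δ)^θ U = (4π²)^θ U` (`Torus.fracLaplacian_realTrigPoly`; linearity in real scalars is the
  tree's `Torus.fracLaplacian_const_smul_apply` of `FluidPDE/FractionalNSReynoldsLimit`).
* `LuoTiti2020.shearStress`, `LuoTiti2020.isFracNSReynoldsOn_shearFlow` — **the start of the
  scheme**: `(φU, 0, gℛU)` with `g = φ' + ν(4π²)^θ φ` and `ℛ` the De Lellis–Székelyhidi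
  antidivergence (`FluidPDE/Antidivergence`, `div ℛU = U - ∫U = U`) is a classical solution of the
  fractional Navier–Stokes–Reynolds system on `ℝ × 𝕋³` (`Torus.IsFracNSReynoldsOn univ`): the shear
  flow has no self-advection (`LuoTiti2020.convect_shearField_self`), so the quadratic part
  `v₀ ⊗ v₀ + p₀I` of the printed `R₀` may be dropped for this datum; temporal support in `[1, 3]`
  and a bound `δ₁` for `‖R₀‖_{L^∞_t L¹_x}`.
* `LuoTiti2020.IterStep`, `LuoTiti2020.Stage`, `LuoTiti2020.stages`,
  `LuoTiti2020.support_stages_subset` — the iteration (stages chosen by `Classical.choose` from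
  the Iteration Lemma with prescribed bounds `δ_{q+2} = e_q`; supports stay in a fixed bounded
  interval by summing (2.3) over the thickenings `N_δ`).
* `LuoTiti2020.thm1_shearFlow_of_iterationLemma` — **Theorem 1, main clause, for the shear-flow
  datum**: for `θ ∈ [1, 5/4)`, `ν > 0`, `ε₀ > 0` a weak solution on the line
  (`Torus.IsWeakFracNSSolutionLine`, Luo–Titi Def. 1.1) with compact support in time and
  `∫‖v(t) - u(t)‖ < ε₀` for all `t` (the `L¹` reading of the printed `W^{2θ-1,1}` closeness, as in
  `LuoTiti2020_thm1`): the `C⁰_t L²_x` limit `Torus.stLim` of the stages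
  (`Torus.isWeakFracNSSolutionLine_stLim` of `FluidPDE/FractionalNSReynoldsL2Limit`; the `L²`
  increments `C δ^{1/2}` are summable for `e_q = ε₀ 4^{-(q+1)}`, the stress bounds tend to `0`), and
  Fatou for the `L¹` increments (`∑ e_q = ε₀/3`).
* `LuoTiti2020.exists_nonzero_of_iterationLemma`, `LuoTiti2020_infinitelyMany_of_iterationLemma`,
  `LionsExponentSharpness.of_iterationLemma` — the consequence clause and the barrier from the
  Iteration Lemma (`ε₀ = ¼`, the pairing with `U` at the time where `φ = 1`, time translation, and
  the disjointly supported translates of `LuoTiti2020.infinitelyMany_of_exists_nonzero`).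

With this file the barrier `LionsExponentSharpness` rests on the single research-level named fact
`Torus.LuoTiti2020_iterationLemma` (§3 of the paper: intermittent Beltrami flows after
Buckmaster–Vicol); `#print axioms LionsExponentSharpness.of_iterationLemma` is the kernel
whitelist.

## References

* T. Luo, E. S. Titi, *Non-uniqueness of weak solutions to hyperviscous Navier–Stokes equations:
  on sharpness of J.-L. Lions exponent*, Calc. Var. PDE 59 (2020), Paper 92 = arXiv:1808.07595
  (held text): §1 Def. 1.1 and Theorem 1; §2.1 (2.1), the Iteration Lemma (Lemma 1) with
  (2.1)–(2.5), and the proof of Theorem 1 (p. 4); Lemma 5 (symmetric anti-divergence).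
  [`LuoTiti2020`]
* C. De Lellis, L. Székelyhidi Jr., Invent. Math. 193 (2013), §4.1 (the operator `ℛ`).
  [`DeLellisSzekelyhidiInvent2013`]
-/

noncomputable section

open MeasureTheory Set Filter Function Topology
open scoped ENNReal NNReal InnerProductSpace ContDiff
open Literature.Analysis

namespace Literature.Barriers.NavierStokesRegularity

local notation "𝕋³" => UnitAddTorus (Fin 3)
local notation "ℝ³" => EuclideanSpace ℝ (Fin 3)

namespace LuoTiti2020

open FunctionSpaces FunctionSpaces.Torus FluidPDE FluidPDE.Torus

/-! ## The fractional Laplacian of the shear field -/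

/-- The shear field is an eigenfunction of `(-Δ)^θ`: `(-Δ)^θ U = (4π²)^θ U` (its frequencies
`±e₂` have `|k|² = 1`; `Torus.fracLaplacian_realTrigPoly`). [folklore] -/
theorem fracLaplacian_shearField (θ : ℝ) :
    fracLaplacian θ shearField = (4 * Real.pi ^ 2) ^ θ • shearField := by
  funext x
  rw [shearField, fracLaplacian_realTrigPoly neg_mem_shearModes isConjSymm_shearCoeff, Pi.smul_apply]
  have hσ : ∀ k ∈ shearModes, ((fracSymbol θ k : ℝ) : ℂ) • shearCoeff k =
      ((((4 * Real.pi ^ 2) ^ θ : ℝ) : ℂ) • shearCoeff) k := by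
    intro k hk
    have hk1 : freqNormSq k = 1 := by
      simp only [shearModes, Finset.mem_insert, Finset.mem_singleton] at hk
      rcases hk with rfl | rfl <;> simp [freqNormSq, shearFreq, Fin.sum_univ_three]
    simp only [Pi.smul_apply, fracSymbol, hk1, mul_one]
  rw [realTrigPoly_congr hσ, realTrigPoly_apply, realTrigPoly_apply, trigPoly_smul, Pi.smul_apply,
    Complex.coe_smul, ContinuousLinearMap.map_smul]

/-! ## The start of the scheme: the shear flow as a fractional Navier–Stokes–Reynolds flow -/

/-- The scalar factor `g(t) = φ'(t) + ν(4π²)^θ φ(t)` of the initial stress. [folklore] -/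
def stressFactor (θ ν : ℝ) (t : ℝ) : ℝ :=
  deriv (bump : ℝ → ℝ) t + ν * (4 * Real.pi ^ 2) ^ θ * (bump : ℝ → ℝ) t

/-- **The initial Reynolds stress** `R₀(t) = g(t) ℛU` (`ℛ` the De Lellis–Székelyhidi
antidivergence of `FluidPDE/Antidivergence`, `div ℛU = U - ∫U = U`): with `v₀ = φ(t)U` the shear
flow and `p₀ = 0`, `∂ₜv₀ + (v₀·∇)v₀ + ∇p₀ + ν(-Δ)^θ v₀ = (φ' + ν(4π²)^θ φ) U = div R₀`, since the
shear flow has no self-advection and `U` is an eigenfunction of `(-Δ)^θ`. This is the start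
`R₀ = ℛ(∂ₜv₀ + ν(-Δ)^θ v₀) + v₀ ⊗ v₀ + p₀ I` of Luo–Titi's proof (p. 4) for this datum, for
which the quadratic part may be dropped. [cite: LuoTiti2020, §2.1 proof of Theorem 1 (start of the iteration)] -/
def shearStress (θ ν : ℝ) : ℝ → 𝕋³ → Fin 3 → ℝ³ :=
  fun t x => stressFactor θ ν t • antidivergence shearField x

/-- `φ' = 0` off `[1, 3]` (the complement is open and `φ` vanishes there). [folklore] -/
theorem deriv_bump_eq_zero {t : ℝ} (ht : t ∉ Icc (1 : ℝ) 3) : deriv (bump : ℝ → ℝ) t = 0 := by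
  have hev : (bump : ℝ → ℝ) =ᶠ[𝓝 t] fun _ => (0 : ℝ) := by
    filter_upwards [isClosed_Icc.isOpen_compl.mem_nhds ht] with τ hτ
    exact bump_eq_zero hτ
  rw [hev.deriv_eq, deriv_const]

/-- The stress factor vanishes off `[1, 3]`. [folklore] -/
theorem stressFactor_eq_zero (θ ν : ℝ) {t : ℝ} (ht : t ∉ Icc (1 : ℝ) 3) : stressFactor θ ν t = 0 := by
  simp [stressFactor, deriv_bump_eq_zero ht, bump_eq_zero ht]

/-- The stress factor is smooth. [folklore] -/
theorem contDiff_stressFactor (θ ν : ℝ) : ContDiff ℝ ∞ (stressFactor θ ν) := by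
  have h1 : ContDiff ℝ ∞ (deriv (bump : ℝ → ℝ)) := by
    have h := (bump.contDiff (n := ⊤)).iterate_deriv 1
    simpa using h
  exact h1.add (contDiff_const.mul bump.contDiff)

/-- The stress factor is continuous. [folklore] -/
theorem continuous_stressFactor (θ ν : ℝ) : Continuous (stressFactor θ ν) :=
  (contDiff_stressFactor θ ν).continuous

/-- The initial stress vanishes off `[1, 3]`. [folklore] -/
theorem shearStress_eq_zero (θ ν : ℝ) {t : ℝ} (ht : t ∉ Icc (1 : ℝ) 3) : shearStress θ ν t = 0 := by
  funext x
  simp [shearStress, stressFactor_eq_zero θ ν ht]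

/-- `∂ₜ(φ U) = φ' U`. [folklore] -/
theorem timeDeriv_shearFlow (t : ℝ) (x : 𝕋³) :
    timeDeriv shearFlow t x = deriv (bump : ℝ → ℝ) t • shearField x := by
  have hd : HasDerivAt (fun τ => (bump : ℝ → ℝ) τ • shearField x)
      (deriv (bump : ℝ → ℝ) t • shearField x) t :=
    ((bump.contDiff (n := ⊤)).differentiable (by simp)).differentiableAt.hasDerivAt.smul_const _
  exact hd.deriv

/-- The second and third components of the shear field vanish (`U = cos(2πx₂) e₁`). [folklore] -/
theorem shearField_apply_of_ne_zero (x : 𝕋³) {i : Fin 3} (hi : i ≠ 0) : shearField x i = 0 := by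
  rw [shearField, realTrigPoly_apply_coord, trigPoly_apply_coord]
  have h : ∀ k, shearCoeff k i = 0 := fun k => by
    simp [shearCoeff, EuclideanSpace.complexify_apply, hi]
  simp [h]

/-- The shear field does not depend on `x₁`: `∂₁ U = 0`. [folklore] -/
theorem partialDeriv_zero_shearField : partialDeriv 0 shearField = 0 := by
  rw [shearField, partialDeriv_realTrigPoly']
  have h : ∀ k ∈ shearModes, (2 * Real.pi * Complex.I * (k 0 : ℂ)) • shearCoeff k =
      (fun _ => (0 : EuclideanSpace ℂ (Fin 3))) k := by
    intro k hk
    simp only [shearModes, Finset.mem_insert, Finset.mem_singleton] at hk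
    rcases hk with rfl | rfl <;> simp [shearFreq]
  rw [realTrigPoly_congr h]
  exact realTrigPoly_zero _

/-- **The shear flow has no self-advection**: `(U·∇)U = 0` (`U` points along `e₁` and does not
depend on `x₁`). [folklore] -/
theorem convect_shearField_self (x : 𝕋³) : convect shearField shearField x = 0 := by
  unfold convect
  rw [fderiv_apply_eq_sum_partialDeriv (isSmooth_shearField.isContDiff (by simp)), Fin.sum_univ_three,
    shearField_apply_of_ne_zero x (i := 1) (by decide), shearField_apply_of_ne_zero x (i := 2) (by decide),
    partialDeriv_zero_shearField]
  simp

/-- The tensor `ℛU` is smooth. [folklore] -/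
theorem isSmooth_antidivergence_shearField : IsSmooth (antidivergence shearField) :=
  isSmooth_antidivergence isSmooth_shearField

/-- **The start of the scheme**: `(φU, 0, g ℛU)` is a classical solution of the fractional
Navier–Stokes–Reynolds system on `ℝ × 𝕋³`, for every exponent `θ` and viscosity `ν`
(Luo–Titi 2020, p. 4: "Clearly `(v₀, R₀)` solves (2.1)").
[cite: LuoTiti2020, §2.1 proof of Theorem 1 (start of the iteration)] -/
theorem isFracNSReynoldsOn_shearFlow (θ ν : ℝ) :
    IsFracNSReynoldsOn univ θ ν shearFlow (fun _ _ => 0) (shearStress θ ν) where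
  smooth_velocity := contDiff_stLift_shearFlow.contDiffOn
  smooth_pressure := contDiffOn_const
  smooth_stress := by
    have h : stLift (shearStress θ ν) = fun q : ℝ × EuclideanSpace ℝ (Fin 3) =>
        stressFactor θ ν q.1 • lift (antidivergence shearField) q.2 := rfl
    unfold IsSmoothSpaceTimeOn
    rw [h]
    exact (((contDiff_stressFactor θ ν).comp contDiff_fst).smul
      (isSmooth_antidivergence_shearField.comp contDiff_snd)).contDiffOn
  momentum t _ x := by
    rw [FluidPDE.Torus.timeDerivWithin_univ, timeDeriv_shearFlow]
    -- self-advection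
    have hconv : convect (shearFlow t) (shearFlow t) x = 0 := by
      have hsf : shearFlow t = (bump : ℝ → ℝ) t • shearField := rfl
      rw [hsf]
      unfold convect
      rw [fderiv_const_smul (isSmooth_shearField.isContDiff (by simp)), FunLike.coe_smul,
        Pi.smul_apply, Pi.smul_apply, map_smul]
      have h0 : Torus.fderiv shearField x (shearField x) = 0 := convect_shearField_self x
      rw [h0, smul_zero, smul_zero]
    -- pressure
    have hgrad : Torus.gradient (fun _ : 𝕋³ => (0 : ℝ)) x = 0 := gradient_zero x
    -- hyperviscosity
    have hΛ : fracLaplacian θ (shearFlow t) x = ((4 * Real.pi ^ 2) ^ θ * (bump : ℝ → ℝ) t) • shearField x := by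
      have hsf : shearFlow t = (bump : ℝ → ℝ) t • shearField := rfl
      rw [hsf, fracLaplacian_const_smul_apply, fracLaplacian_shearField, Pi.smul_apply, smul_smul,
        mul_comm]
    -- the stress
    have hdiv : tensorDivergence (shearStress θ ν t) x = stressFactor θ ν t • shearField x := by
      have hst : shearStress θ ν t = stressFactor θ ν t • antidivergence shearField := rfl
      rw [hst, tensorDivergence_const_smul (isSmooth_antidivergence_shearField.isContDiff (by simp)),
        tensorDivergence_antidivergence (by simp) isSmooth_shearField, integral_shearField, sub_zero]
    rw [hconv, hgrad, hΛ, hdiv, add_zero, add_zero, smul_smul, ← add_smul, stressFactor]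
    ring_nf
  divFree t _ := isDivFree_shearFlow t
  symm t _ x i j := by
    change stressFactor θ ν t • antidivergence shearField x i j =
      stressFactor θ ν t • antidivergence shearField x j i
    rw [antidivergence_symm isSmooth_shearField x i j]

/-- The start has temporal support in `[1, 3]`. [folklore] -/
theorem support_shearFlow_union_subset (θ ν : ℝ) :
    Function.support shearFlow ∪ Function.support (shearStress θ ν) ⊆ Icc 1 3 := by
  rintro t (ht | ht)
  · by_contra h
    exact ht (shearFlow_eq_zero t h)
  · by_contra h
    exact ht (shearStress_eq_zero θ ν h)

/-- A bound `δ₁` for `‖R₀‖_{L^∞_t L¹_x}`. [folklore] -/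
theorem exists_stress_bound (θ ν : ℝ) : ∃ δ₁ : ℝ, 0 < δ₁ ∧ ∀ t, ∫ x, ‖shearStress θ ν t x‖ ≤ δ₁ := by
  obtain ⟨G, hG⟩ := (continuous_stressFactor θ ν).norm.bddAbove_range_of_hasCompactSupport
    ((HasCompactSupport.intro isCompact_Icc fun t ht => stressFactor_eq_zero θ ν ht).norm)
  obtain ⟨A, hA⟩ := isCompact_univ.exists_bound_of_continuousOn
    isSmooth_antidivergence_shearField.continuous.continuousOn
  have hG' : ∀ t, ‖stressFactor θ ν t‖ ≤ G := fun t => hG ⟨t, rfl⟩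
  have hA' : ∀ x, ‖antidivergence shearField x‖ ≤ A := fun x => hA x (mem_univ x)
  have hG0 : 0 ≤ G := (norm_nonneg _).trans (hG' 0)
  have hA0 : 0 ≤ A := (norm_nonneg _).trans (hA' 0)
  refine ⟨G * A + 1, by positivity, fun t => ?_⟩
  calc ∫ x, ‖shearStress θ ν t x‖ ≤ ∫ _ : 𝕋³, G * A := by
        refine integral_mono_of_nonneg (ae_of_all _ fun x => norm_nonneg _) (integrable_const _)
          (ae_of_all _ fun x => ?_)
        change ‖stressFactor θ ν t • antidivergence shearField x‖ ≤ G * A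
        rw [norm_smul]
        exact mul_le_mul (hG' t) (hA' x) (norm_nonneg _) hG0
    _ = G * A := by simp
    _ ≤ G * A + 1 := by linarith

/-! ## The iteration -/

/-- One step of the scheme with the constant `C` fixed: the matrix of
`Torus.LuoTiti2020_iterationLemma` after its `∃ C`. [cite: LuoTiti2020, §2.1 Iteration Lemma (Lemma 1 of arXiv:1808.07595)] -/
def IterStep (θ ν C : ℝ) : Prop :=
  ∀ (v : ℝ → 𝕋³ → ℝ³) (p : ℝ → 𝕋³ → ℝ) (R : ℝ → 𝕋³ → Fin 3 → ℝ³) (δ₁ δ₂ : ℝ),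
    IsFracNSReynoldsOn univ θ ν v p R →
    Bornology.IsBounded (Function.support v ∪ Function.support R) →
    0 < δ₁ → 0 < δ₂ → (∀ t, ∫ x, ‖R t x‖ ≤ δ₁) →
    ∃ (v' : ℝ → 𝕋³ → ℝ³) (p' : ℝ → 𝕋³ → ℝ) (R' : ℝ → 𝕋³ → Fin 3 → ℝ³),
      IsFracNSReynoldsOn univ θ ν v' p' R' ∧
      (∀ t, ∫ x, ‖R' t x‖ ≤ δ₂) ∧
      Function.support v' ∪ Function.support R' ⊆
        Metric.thickening δ₁ (Function.support v ∪ Function.support R) ∧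
      (∀ t, eLpNorm (v' t - v t) 2 volume ≤ ENNReal.ofReal (C * Real.sqrt δ₁)) ∧
      (∀ t, ∫ x, ‖v' t x - v t x‖ ≤ δ₂)

/-- The Iteration Lemma provides a constant `C > 0` and the step `IterStep θ ν C`. [folklore] -/
theorem exists_iterStep (h : FluidPDE.Torus.LuoTiti2020_iterationLemma) {θ ν : ℝ} (h1 : 1 ≤ θ)
    (h2 : θ < 5 / 4) (hν : 0 < ν) : ∃ C : ℝ, 0 < C ∧ IterStep θ ν C :=
  h θ ν h1 h2 hν

/-- A stage of the scheme: a classical fractional Navier–Stokes–Reynolds flow on `ℝ × 𝕋³` with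
bounded temporal support and a bound `δ` for `‖R‖_{L^∞_t L¹_x}` (the hypotheses (2.1) of the
Iteration Lemma). [cite: LuoTiti2020, §2.1 Iteration Lemma, hypotheses] -/
structure Stage (θ ν : ℝ) where
  /-- The velocity. -/
  v : ℝ → 𝕋³ → ℝ³
  /-- The pressure. -/
  p : ℝ → 𝕋³ → ℝ
  /-- The stress. -/
  R : ℝ → 𝕋³ → Fin 3 → ℝ³
  /-- The stress bound `δ`. -/
  δ : ℝ
  /-- The triple solves the fractional Navier–Stokes–Reynolds system on `ℝ × 𝕋³`. -/
  sol : IsFracNSReynoldsOn univ θ ν v p R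
  /-- Bounded temporal support. -/
  bdd : Bornology.IsBounded (Function.support v ∪ Function.support R)
  /-- The bound is positive. -/
  δ_pos : 0 < δ
  /-- `‖R‖_{L^∞_t L¹_x} ≤ δ`. -/
  stress_le : ∀ t, ∫ x, ‖R t x‖ ≤ δ

/-- The relations between consecutive stages delivered by one step: new stress bound `δ'`,
support in the `δ`-neighbourhood, and the `L²`/`L¹` increments (2.3)–(2.5). [folklore] -/
def StageRel {θ ν : ℝ} (C : ℝ) (s s' : Stage θ ν) : Prop :=
  Function.support s'.v ∪ Function.support s'.R ⊆
      Metric.thickening s.δ (Function.support s.v ∪ Function.support s.R) ∧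
    (∀ t, eLpNorm (s'.v t - s.v t) 2 volume ≤ ENNReal.ofReal (C * Real.sqrt s.δ)) ∧
    (∀ t, ∫ x, ‖s'.v t x - s.v t x‖ ≤ s'.δ)

/-- One step: from a stage and a target bound `δ' > 0`, a next stage with bound `δ'`. [folklore] -/
theorem exists_next {θ ν C : ℝ} (hstep : IterStep θ ν C) (s : Stage θ ν) {δ' : ℝ} (hδ' : 0 < δ') :
    ∃ s' : Stage θ ν, s'.δ = δ' ∧ StageRel C s s' := by
  obtain ⟨v', p', R', hsol, hR, hsupp, hL2, hL1⟩ :=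
    hstep s.v s.p s.R s.δ δ' s.sol s.bdd s.δ_pos hδ' s.stress_le
  refine ⟨⟨v', p', R', δ', hsol, ?_, hδ', hR⟩, rfl, hsupp, hL2, hL1⟩
  exact (s.bdd.thickening (δ := s.δ)).subset hsupp

/-- The sequence of stages: `s₀`, then repeatedly the next stage with the prescribed bounds
`e q` (Luo–Titi: `δ_{q+2} = 2^{-(q+1)} ε₀`; here any positive sequence). [folklore] -/
def stages {θ ν C : ℝ} (hstep : IterStep θ ν C) (s₀ : Stage θ ν) (e : ℕ → ℝ)
    (he : ∀ q, 0 < e q) : ℕ → Stage θ ν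
  | 0 => s₀
  | q + 1 => Classical.choose (exists_next hstep (stages hstep s₀ e he q) (he q))

/-- The defining relations of the sequence of stages. [folklore] -/
theorem stages_succ_spec {θ ν C : ℝ} (hstep : IterStep θ ν C) (s₀ : Stage θ ν) (e : ℕ → ℝ)
    (he : ∀ q, 0 < e q) (q : ℕ) :
    (stages hstep s₀ e he (q + 1)).δ = e q ∧
      StageRel C (stages hstep s₀ e he q) (stages hstep s₀ e he (q + 1)) :=
  Classical.choose_spec (exists_next hstep (stages hstep s₀ e he q) (he q))

/-- `stages … 0 = s₀`. [folklore] -/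
theorem stages_zero {θ ν C : ℝ} (hstep : IterStep θ ν C) (s₀ : Stage θ ν) (e : ℕ → ℝ)
    (he : ∀ q, 0 < e q) : stages hstep s₀ e he 0 = s₀ := rfl

/-- **Uniform temporal support along the scheme**: if the start is supported in `[1, 3]` then
every stage is supported in the `T`-neighbourhood of `[1, 3]` with
`T = 1 + δ₀ + ∑_q e_q` (summing (2.3): `supp ⊂ N_{∑ δ}`, Luo–Titi p. 4). [cite: LuoTiti2020, §2.1 proof of Theorem 1 (support)] -/
theorem support_stages_subset {θ ν C : ℝ} (hstep : IterStep θ ν C) (s₀ : Stage θ ν) (e : ℕ → ℝ)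
    (he : ∀ q, 0 < e q) (hs₀ : Function.support s₀.v ∪ Function.support s₀.R ⊆ Icc 1 3)
    (hes : Summable e) (q : ℕ) :
    Function.support (stages hstep s₀ e he q).v ∪ Function.support (stages hstep s₀ e he q).R ⊆
      Ioo (1 - (1 + s₀.δ + ∑' i, e i)) (3 + (1 + s₀.δ + ∑' i, e i)) := by
  -- the radii
  set T : ℕ → ℝ := fun q => 1 + ∑ j ∈ Finset.range q, (stages hstep s₀ e he j).δ with hT_def
  have hδ : ∀ j, (stages hstep s₀ e he j).δ = if j = 0 then s₀.δ else e (j - 1) := by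
    intro j
    cases j with
    | zero => simp [stages_zero]
    | succ i => simp [(stages_succ_spec hstep s₀ e he i).1]
  have hTle : ∀ q, T q ≤ 1 + s₀.δ + ∑' i, e i := by
    intro q
    have h1 : ∑ j ∈ Finset.range q, (stages hstep s₀ e he j).δ ≤ s₀.δ + ∑' i, e i := by
      cases q with
      | zero =>
        simp only [Finset.range_zero, Finset.sum_empty]
        exact add_nonneg s₀.δ_pos.le (tsum_nonneg fun i => (he i).le)
      | succ n =>
        rw [Finset.sum_range_succ']
        simp only [hδ, Nat.succ_ne_zero, ↓reduceIte, Nat.add_sub_cancel]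
        rw [add_comm]
        refine add_le_add le_rfl ?_
        exact hes.sum_le_tsum _ (fun i _ => (he i).le)
    simp only [hT_def]
    linarith
  -- induction on `q`: support ⊆ thickening (T q) of the start
  have hind : ∀ q, Function.support (stages hstep s₀ e he q).v ∪
      Function.support (stages hstep s₀ e he q).R ⊆
        Metric.thickening (T q) (Function.support s₀.v ∪ Function.support s₀.R) := by
    intro q
    induction q with
    | zero =>
      simp only [hT_def, Finset.range_zero, Finset.sum_empty, add_zero, stages_zero]
      exact Metric.self_subset_thickening one_pos _
    | succ n ih =>
      have hrel := (stages_succ_spec hstep s₀ e he n).2.1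
      refine hrel.trans ((Metric.thickening_subset_of_subset _ ih).trans ?_)
      refine (Metric.thickening_thickening_subset _ _ _).trans (le_of_eq ?_)
      simp only [hT_def, Finset.sum_range_succ]
      ring_nf
  refine (hind q).trans ((Metric.thickening_mono (hTle q) _).trans ?_)
  intro t ht
  rw [Metric.mem_thickening_iff] at ht
  obtain ⟨z, hz, hdist⟩ := ht
  have hz' := hs₀ hz
  rw [Real.dist_eq] at hdist
  have h0 : 0 ≤ 1 + s₀.δ + ∑' i, e i := by
    have h00 : 0 ≤ ∑' i, e i := tsum_nonneg fun i => (he i).le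
    linarith [s₀.δ_pos]
  constructor
  · linarith [hz'.1, (abs_sub_lt_iff.1 hdist).1, (abs_sub_lt_iff.1 hdist).2]
  · linarith [hz'.2, (abs_sub_lt_iff.1 hdist).1, (abs_sub_lt_iff.1 hdist).2]

/-! ## Theorem 1 (main clause) for the shear-flow datum, from the Iteration Lemma -/

/-- `√(ε / 4^{q+1}) = √ε / 2^{q+1}`. [folklore] -/
theorem sqrt_div_four_pow {ε : ℝ} (hε : 0 ≤ ε) (q : ℕ) :
    Real.sqrt (ε / 4 ^ (q + 1)) = Real.sqrt ε / 2 ^ (q + 1) := by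
  rw [Real.sqrt_div hε, show (4 : ℝ) ^ (q + 1) = (2 ^ (q + 1)) ^ 2 by
    rw [← pow_mul, mul_comm, pow_mul]; norm_num, Real.sqrt_sq (by positivity)]

/-- **Luo–Titi's Theorem 1, main clause, for the shear-flow datum `u = φ(t) cos(2πx₂) e₁`,
from the Iteration Lemma** (the printed proof, p. 4, run for this `u`): for `θ ∈ [1, 5/4)`,
`ν > 0` and `ε₀ > 0` there is a weak solution `v` on the line (`Torus.IsWeakFracNSSolutionLine`)
with compact support in time and `∫‖v(t) - u(t)‖ < ε₀` for every `t` — i.e. the statement of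
the named fact `LuoTiti2020_thm1` of `LionsExponentSharpnessProofs` specialised to this datum
(with its `L¹` reading of the `W^{2θ-1,1}` closeness). Proof: start `(φU, 0, gℛU)`
(`isFracNSReynoldsOn_shearFlow`); iterate `Torus.LuoTiti2020_iterationLemma` with
`δ_{q+2} = ε₀ 4^{-(q+1)}`; the `L²` increments `C δ_{q+1}^{1/2}` are summable, the supports stay in
a fixed bounded interval and `‖R_q‖_{L^∞L¹} → 0`, so the `C⁰_t L²_x` limit is a weak solution
(`Torus.isWeakFracNSSolutionLine_stLim`); the `L¹` increments sum to `ε₀/3 < ε₀` (Fatou).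
[cite: LuoTiti2020, §1 Theorem 1 and §2.1 proof of Theorem 1 (p. 4 of arXiv:1808.07595)] -/
theorem thm1_shearFlow_of_iterationLemma (h : FluidPDE.Torus.LuoTiti2020_iterationLemma) {θ ν : ℝ}
    (h1 : 1 ≤ θ) (h2 : θ < 5 / 4) (hν : 0 < ν) {ε₀ : ℝ} (hε₀ : 0 < ε₀) :
    ∃ v : ℝ → 𝕋³ → ℝ³, FluidPDE.Torus.IsWeakFracNSSolutionLine θ ν v ∧
      (∃ a' b' : ℝ, ∀ t, t ∉ Icc a' b' → v t = 0) ∧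
      ∀ t, ∫⁻ x, ‖v t x - shearFlow t x‖ₑ < ENNReal.ofReal ε₀ := by
  have hθ : 0 ≤ θ := by linarith
  obtain ⟨C, hC0, hstep⟩ := exists_iterStep h h1 h2 hν
  obtain ⟨δ₁, hδ₁, hR₀⟩ := exists_stress_bound θ ν
  -- the start
  set s₀ : Stage θ ν := ⟨shearFlow, fun _ _ => 0, shearStress θ ν, δ₁, isFracNSReynoldsOn_shearFlow θ ν,
    (Metric.isBounded_Icc 1 3).subset (support_shearFlow_union_subset θ ν), hδ₁, hR₀⟩ with hs₀_def
  -- the bounds `e q = ε₀ / 4^(q+1)`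
  set e : ℕ → ℝ := fun q => ε₀ / 4 ^ (q + 1) with he_def
  have he : ∀ q, 0 < e q := fun q => by positivity
  have he_eq : ∀ q, e q = ε₀ / 4 * (1 / 4) ^ q := fun q => by
    simp only [he_def]
    rw [one_div_pow, div_mul_div_comm, mul_one, ← pow_succ']
  have hes : Summable e := by
    have h := (summable_geometric_of_lt_one (by norm_num : (0 : ℝ) ≤ 1 / 4)
      (by norm_num : (1 / 4 : ℝ) < 1)).mul_left (ε₀ / 4)
    exact h.congr fun q => (he_eq q).symm
  have hesum : ∑' q, e q = ε₀ / 3 := by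
    have h := (tsum_geometric_of_lt_one (by norm_num : (0 : ℝ) ≤ 1 / 4)
      (by norm_num : (1 / 4 : ℝ) < 1))
    have h' : ∑' q, e q = ε₀ / 4 * ∑' q : ℕ, (1 / 4 : ℝ) ^ q := by
      rw [← tsum_mul_left]
      exact tsum_congr he_eq
    rw [h', h]
    norm_num
    ring
  -- the stages and the extracted sequences
  set S : ℕ → Stage θ ν := stages hstep s₀ e he with hS_def
  set v : ℕ → ℝ → 𝕋³ → ℝ³ := fun q => (S q).v with hv_def
  have hsol : ∀ q, IsFracNSReynoldsOn univ θ ν (v q) (S q).p (S q).R := fun q => (S q).sol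
  have hδS : ∀ q, (S (q + 1)).δ = e q := fun q => (stages_succ_spec hstep s₀ e he q).1
  have hrel : ∀ q, StageRel C (S q) (S (q + 1)) := fun q => (stages_succ_spec hstep s₀ e he q).2
  have hv0 : v 0 = shearFlow := rfl
  -- uniform support
  set Tr : ℝ := 1 + δ₁ + ∑' i, e i with hTr_def
  have hsuppS : ∀ q, Function.support (S q).v ∪ Function.support (S q).R ⊆ Ioo (1 - Tr) (3 + Tr) :=
    fun q => support_stages_subset hstep s₀ e he (support_shearFlow_union_subset θ ν) hes q
  have hsupp : ∀ q t, t ∉ Ioo (1 - Tr) (3 + Tr) → v q t = 0 := by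
    intro q t ht
    by_contra hne
    exact ht (hsuppS q (Or.inl (Function.mem_support.2 hne)))
  -- the `L²` increments
  set β : ℕ → ℝ≥0∞ := fun q => ENNReal.ofReal (C * Real.sqrt (S q).δ) with hβ_def
  have hβ : ∀ q t, eLpNorm (v (q + 1) t - v q t) 2 volume ≤ β q := fun q t => (hrel q).2.1 t
  have hβs : ∑' q, β q ≠ ⊤ := by
    have hnn : ∀ q, 0 ≤ C * Real.sqrt (S q).δ := fun q => mul_nonneg hC0.le (Real.sqrt_nonneg _)
    have hsum : Summable fun q => C * Real.sqrt (S q).δ := by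
      rw [← summable_nat_add_iff 1]
      have h : (fun q => C * Real.sqrt (S (q + 1)).δ) = fun q => C * Real.sqrt ε₀ / 2 * (1 / 2) ^ q := by
        funext q
        rw [hδS q]
        simp only [he_def]
        rw [sqrt_div_four_pow hε₀.le, one_div_pow, div_mul_div_comm, mul_one, ← pow_succ',
          mul_div_assoc]
      rw [h]
      exact (summable_geometric_of_lt_one (by norm_num) (by norm_num)).mul_left _
    rw [hβ_def, ← ENNReal.ofReal_tsum_of_nonneg hnn hsum]
    exact ENNReal.ofReal_ne_top
  -- the stress tends to zero in `L^∞_t L¹_x`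
  have hR : ∀ ε : ℝ, 0 < ε → ∃ N, ∀ q ≥ N, ∀ t, ∫ x, ‖(S q).R t x‖ ≤ ε := by
    intro ε hε
    have ht : Tendsto e atTop (𝓝 0) := hes.tendsto_atTop_zero
    obtain ⟨N, hN⟩ := (Metric.tendsto_atTop.1 ht) ε hε
    refine ⟨N + 1, fun q hq t => ?_⟩
    obtain ⟨m, rfl⟩ := Nat.exists_eq_add_of_le hq
    have hq' : (S (N + 1 + m)).δ = e (N + m) := by
      rw [show N + 1 + m = (N + m) + 1 by ring]
      exact hδS (N + m)
    calc ∫ x, ‖(S (N + 1 + m)).R t x‖ ≤ (S (N + 1 + m)).δ := (S (N + 1 + m)).stress_le t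
      _ = e (N + m) := hq'
      _ ≤ ε := by
          have h := hN (N + m) (Nat.le_add_right N m)
          rw [Real.dist_eq, sub_zero, abs_of_pos (he _)] at h
          exact h.le
  -- the limit
  set w : ℝ → 𝕋³ → ℝ³ := FluidPDE.Torus.stLim v with hw_def
  have hw : FluidPDE.Torus.IsWeakFracNSSolutionLine θ ν w :=
    FluidPDE.Torus.isWeakFracNSSolutionLine_stLim hθ hsol hsupp hβ hβs hR
  have hwsupp : ∀ t, t ∉ Icc (1 - Tr) (3 + Tr) → w t = 0 := fun t ht =>
    FluidPDE.Torus.stLim_eq_zero fun q => hsupp q t fun ht' => ht (Ioo_subset_Icc_self ht')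
  refine ⟨w, hw, ⟨1 - Tr, 3 + Tr, hwsupp⟩, fun t => ?_⟩
  -- `L¹` closeness to the start
  have hcont : ∀ q, Continuous (Function.uncurry (v q)) := fun q =>
    FluidPDE.Torus.continuous_uncurry_of_isSmoothSpaceTimeOn (hsol q).smooth_velocity
  have hvm : ∀ q t, AEStronglyMeasurable (v q t) volume := fun q t =>
    ((hcont q).comp (continuous_const.prodMk continuous_id)).aestronglyMeasurable
  have hlim : ∀ t, ∀ᵐ x, Tendsto (fun q => v q t x) atTop (𝓝 (w t x)) :=
    FluidPDE.Torus.ae_tendsto_stLim hvm hβ hβs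
  have hc1 : ∀ q, eLpNorm (v (q + 1) t - v q t) 1 volume ≤ ENNReal.ofReal (e q) := by
    intro q
    have hcq : Continuous fun x => v (q + 1) t x - v q t x :=
      ((hcont (q + 1)).comp (continuous_const.prodMk continuous_id)).sub
        ((hcont q).comp (continuous_const.prodMk continuous_id))
    rw [eLpNorm_one_eq_lintegral_enorm]
    show ∫⁻ x, ‖v (q + 1) t x - v q t x‖ₑ ≤ _
    rw [← ofReal_integral_norm_eq_lintegral_enorm hcq.integrable_unitAddTorus]
    refine ENNReal.ofReal_le_ofReal ?_
    have h := (hrel q).2.2 t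
    rw [hδS q] at h
    exact h
  have hL1 : eLpNorm (w t - v 0 t) 1 volume ≤ ∑' k, ENNReal.ofReal (e (0 + k)) :=
    FluidPDE.Torus.eLpNorm_lim_sub_le (fun q => hvm q t) (hlim t) le_rfl hc1 0
  simp only [zero_add] at hL1
  rw [← ENNReal.ofReal_tsum_of_nonneg (fun q => (he q).le) hes, hesum] at hL1
  calc ∫⁻ x, ‖w t x - shearFlow t x‖ₑ = eLpNorm (w t - v 0 t) 1 volume := by
        rw [eLpNorm_one_eq_lintegral_enorm]; rfl
    _ ≤ ENNReal.ofReal (ε₀ / 3) := hL1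
    _ < ENNReal.ofReal ε₀ := (ENNReal.ofReal_lt_ofReal_iff hε₀).2 (by linarith)

/-! ## The consequence clause from the Iteration Lemma -/

/-- **A non-zero weak solution with zero initial values from the Iteration Lemma** (as
`exists_nonzero_of_thm1`, with `thm1_shearFlow_of_iterationLemma` in place of the named fact
`LuoTiti2020_thm1`): `ε₀ = ¼`, and at the time where `φ = 1` the pairing with the shear field is
within `¼` of `½`; then a time translation. [cite: LuoTiti2020, §2, end of the proof of Theorem 1] -/
theorem exists_nonzero_of_iterationLemma (h : FluidPDE.Torus.LuoTiti2020_iterationLemma) {θ ν : ℝ}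
    (h1 : 1 ≤ θ) (h2 : θ < 5 / 4) (hν : 0 < ν) :
    ∃ v : ℝ → 𝕋³ → ℝ³, FluidPDE.Torus.IsWeakFracNSSolutionLine θ ν v ∧ (∀ t : ℝ, t ≤ 0 → v t = 0) ∧
      (∃ b : ℝ, ∀ t : ℝ, b ≤ t → v t = 0) ∧ ∃ t₀ : ℝ, ∫ x, ⟪v t₀ x, shearField x⟫_ℝ ≠ 0 := by
  obtain ⟨v, hv, ⟨a', b', hsupp⟩, hclose⟩ :=
    thm1_shearFlow_of_iterationLemma h h1 h2 hν (ε₀ := 1 / 4) (by norm_num)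
  have hsf : Continuous shearField := isSmooth_shearField.continuous
  have hv2 : MemLp (v 2) 2 volume := hv.2.1 2
  have hu2 : Continuous (shearFlow 2) := by
    change Continuous fun x => (bump : ℝ → ℝ) 2 • shearField x
    exact (continuous_const (y := (bump : ℝ → ℝ) 2)).smul hsf
  have hmeas : AEStronglyMeasurable (fun x => v 2 x - shearFlow 2 x) volume :=
    hv2.aestronglyMeasurable.sub hu2.aestronglyMeasurable
  have hint1 : Integrable (fun x => ⟪v 2 x, shearField x⟫_ℝ) volume := by
    refine Integrable.mono' (hv2.integrable one_le_two).norm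
      (hv2.aestronglyMeasurable.inner hsf.aestronglyMeasurable) (ae_of_all _ fun x => ?_)
    exact (norm_inner_le_norm _ _).trans
      (mul_le_of_le_one_right (norm_nonneg _) (norm_shearField_le_one x))
  have hint2 : Integrable (fun x => ⟪shearFlow 2 x, shearField x⟫_ℝ) volume :=
    (hu2.inner hsf).integrable_unitAddTorus
  have hL1 : ∫ x, ‖v 2 x - shearFlow 2 x‖ < 1 / 4 := by
    rw [integral_norm_eq_lintegral_enorm hmeas]
    exact ENNReal.toReal_lt_of_lt_ofReal (hclose 2)
  have hdiff : |(∫ x, ⟪v 2 x, shearField x⟫_ℝ) - 1 / 2| ≤ 1 / 4 := by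
    rw [← integral_inner_shearFlow_two, ← integral_sub hint1 hint2]
    have heq : ∫ x, (⟪v 2 x, shearField x⟫_ℝ - ⟪shearFlow 2 x, shearField x⟫_ℝ) =
        ∫ x, ⟪v 2 x - shearFlow 2 x, shearField x⟫_ℝ :=
      integral_congr_ae (ae_of_all _ fun x => (inner_sub_left _ _ _).symm)
    rw [heq, ← Real.norm_eq_abs]
    refine (norm_integral_le_of_norm_le
      ((hv2.integrable one_le_two).sub hu2.integrable_unitAddTorus).norm
      (ae_of_all _ fun x => ?_)).trans hL1.le
    exact (norm_inner_le_norm _ _).trans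
      (mul_le_of_le_one_right (norm_nonneg _) (norm_shearField_le_one x))
  have hne : ∫ x, ⟪v 2 x, shearField x⟫_ℝ ≠ 0 := by
    intro h0
    rw [h0] at hdiff
    norm_num at hdiff
  refine ⟨fun t => v (t + (a' - 1)), hv.comp_add_right _, ?_, ⟨b' - a' + 2, ?_⟩, 3 - a', ?_⟩
  · intro t ht
    exact hsupp _ fun hm => by linarith [hm.1]
  · intro t ht
    exact hsupp _ fun hm => by linarith [hm.2]
  · have h3 : 3 - a' + (a' - 1) = 2 := by ring
    dsimp only
    rw [h3]
    exact hne

end LuoTiti2020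

/-- **Luo–Titi 2020, Theorem 1, consequence clause, from the Iteration Lemma** ("As a
consequence there are infinitely many weak solutions of the FVNSE (1.1) which are compactly
supported in time; in particular, there are infinitely many weak solutions with initial values
zero"): the named fact `Torus.LuoTiti2020_iterationLemma` (Lemma 1 = the one-step statement of
the intermittent convex-integration scheme, `FluidPDE/FractionalNSReynolds`) implies the
catalogue's named fact `LuoTiti2020_infinitelyMany`. Lean content = the printed proof of
Theorem 1 (p. 4 of the arXiv text) run for the shear-flow datum: the start `(φU, 0, gℛU)`, the
iteration, the `C⁰_t L²_x` limit (`Torus.isWeakFracNSSolutionLine_stLim` of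
`FluidPDE/FractionalNSReynoldsL2Limit`), `L¹` closeness, and the disjointly supported translates of
`LuoTiti2020.infinitelyMany_of_exists_nonzero`.
[cite: LuoTiti2020, §1 Theorem 1; §2.1 Iteration Lemma and proof of Theorem 1] -/
theorem LuoTiti2020_infinitelyMany_of_iterationLemma (h : FluidPDE.Torus.LuoTiti2020_iterationLemma) :
    LuoTiti2020_infinitelyMany := by
  intro θ ν h1 h2 hν
  obtain ⟨v, hv, h0, ⟨b, hb⟩, t₀, hne⟩ := LuoTiti2020.exists_nonzero_of_iterationLemma h h1 h2 hν
  exact LuoTiti2020.infinitelyMany_of_exists_nonzero hv h0 hb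
    (LuoTiti2020.isSmooth_shearField.memLp 2) hne

/-- **The barrier `LionsExponentSharpness` from Luo–Titi's Iteration Lemma.**
[cite: LuoTiti2020, §1 Theorem 1; §2.1 Iteration Lemma] -/
theorem LionsExponentSharpness.of_iterationLemma (h : FluidPDE.Torus.LuoTiti2020_iterationLemma) :
    LionsExponentSharpness :=
  LuoTiti2020_infinitelyMany_of_iterationLemma h

end Literature.Barriers.NavierStokesRegularity
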